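import Mathlib.Combinatorics.SimpleGraph.Matching
import Mathlib.SetTheory.Cardinal.Finite
import Mathlib.Algebra.BigOperators.Finprod
import Mathlib.Data.Set.Card
import Mathlib.Data.Fintype.Pi
import Mathlib.Data.Fintype.Prod
import Mathlib.Data.Fin.VecNotation
import Literature.Probability.LatticeModels.LatticeGraph
import HarnessLib

/-!
# Counting dimer covers (perfect matchings) of induced sub-graphs

`perfectMatchingCount H S` is the number of *dimer covers* — perfect matchings — of the
sub-graph of a simple graph `H` induced on a vertex set `S`:
`Nat.card {M : (H.induce S).Subgraph // M.IsPerfectMatching}` (Mathlib's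
`SimpleGraph.Subgraph.IsPerfectMatching`). This is the partition function `Z` of the dimer
model with unit edge weights (Kenyon, *Lectures on dimers*, §1.1 and §3.1). The vertex type is
arbitrary; the statistical-mechanics applications take `H : SimpleGraph (Site 2)`, a sub-graph
of `zdGraph 2`.

## Main statements

* `perfectMatchingEquivPartner G`: perfect matchings of `G` are the same as *partner maps*,
  adjacency-respecting involutions `f : W → W` (`G.Adj v (f v)`, `f (f v) = v`); all counting
  below goes through this description.
* `card_perfectMatchings_eq_of_iso`, `perfectMatchingCount_eq_of_iso`, `perfectMatchingCount_congr`,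
  `perfectMatchingCount_image_iso`, `perfectMatchingCount_zdGraph_image_shift`: the count only
  depends on the induced graph up to isomorphism (in particular it is translation invariant
  on `ℤ^d`).
* `perfectMatchingCount_empty`: the empty graph has exactly one dimer cover.
* `finite_perfectMatchings`, `perfectMatchingCount_ne_zero_iff`: for finite `S` the count is a
  genuine cardinality (`Nat.card` of a finite type), non-zero iff a dimer cover exists.
* `perfectMatchingCount_eq_finprod`: multiplicativity over the connected components of
  `H.induce S`.
* `perfectMatchingCount_eq_zero_of_odd`: no dimer cover of an odd number of sites.
* `perfectMatchingCount_eq_zero_of_ncard_ne` (bipartite colour imbalance) and its chessboard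
  specialisation `perfectMatchingCount_eq_zero_of_chessboard` for `H ≤ zdGraph d`.
* `perfectMatchingCount_zdGraph_two_Icc`: a `2 × 2` block of `ℤ²` has exactly `2` dimer covers.

## References

* R. Kenyon, *Lectures on dimers*, IAS/Park City Math. Ser. 16 (2009), arXiv:0910.3129,
  §1.1 (dimer covers = perfect matchings), §3.1 (partition function), §3.4 (proof of Thm 2:
  each dimer covers one white and one black vertex). [Kenyon2009]
* S. Friedli, Y. Velenik, *Statistical Mechanics of Lattice Systems* (2017), §3.1, for `ℤ^d`.

Not here (deliberately): Kasteleyn's determinant/Pfaffian formula (Kenyon2009, Thm 2), a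
theorem about planar graphs to be vendored separately; componentwise products with the
convention "an unmatchable component counts 1" are route-side definitions.
-/

namespace Literature.Probability.LatticeModels

open Finset

/-! ### Perfect matchings as partner maps -/

section Partner

variable {W W' : Type*} {G : SimpleGraph W} {G' : SimpleGraph W'}

/-- The spanning subgraph of `G` whose edges are the pairs `{v, f v}` of an adjacency-respecting
involution `f : W → W` (a *partner map*): the perfect matching with dimers `{v, f v}`.
[folklore] -/
def partnerSubgraph (G : SimpleGraph W) (f : W → W) (hf : ∀ v, G.Adj v (f v) ∧ f (f v) = v) :
    G.Subgraph where
  verts := Set.univ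
  Adj v w := w = f v
  adj_sub := by
    rintro v _ rfl
    exact (hf v).1
  edge_vert _ := Set.mem_univ _
  symm := ⟨by
    rintro v _ rfl
    exact (hf v).2.symm⟩

/-- The subgraph of a partner map is a perfect matching. [folklore] -/
theorem partnerSubgraph_isPerfectMatching (G : SimpleGraph W) (f : W → W)
    (hf : ∀ v, G.Adj v (f v) ∧ f (f v) = v) : (partnerSubgraph G f hf).IsPerfectMatching := by
  rw [SimpleGraph.Subgraph.isPerfectMatching_iff]
  exact fun v => ⟨f v, rfl, fun _ hw => hw⟩

/-- The partner (matched neighbour) of a vertex `v` in a perfect matching `M`: the unique `w`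
with `M.Adj v w` (`SimpleGraph.Subgraph.isPerfectMatching_iff`). [folklore] -/
noncomputable def matchPartner {M : G.Subgraph} (hM : M.IsPerfectMatching) (v : W) : W :=
  (SimpleGraph.Subgraph.isPerfectMatching_iff.1 hM v).choose

/-- A vertex is matched to its partner. [folklore] -/
theorem adj_matchPartner {M : G.Subgraph} (hM : M.IsPerfectMatching) (v : W) :
    M.Adj v (matchPartner hM v) :=
  (SimpleGraph.Subgraph.isPerfectMatching_iff.1 hM v).choose_spec.1

/-- The partner is the only vertex matched to `v`. [folklore] -/
theorem eq_matchPartner_of_adj {M : G.Subgraph} (hM : M.IsPerfectMatching) {v w : W}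
    (h : M.Adj v w) : w = matchPartner hM v :=
  (SimpleGraph.Subgraph.isPerfectMatching_iff.1 hM v).choose_spec.2 w h

/-- The partner map of a perfect matching is an involution. [folklore] -/
theorem matchPartner_matchPartner {M : G.Subgraph} (hM : M.IsPerfectMatching) (v : W) :
    matchPartner hM (matchPartner hM v) = v :=
  (eq_matchPartner_of_adj hM (adj_matchPartner hM v).symm).symm

/-- **Perfect matchings are partner maps.** The perfect matchings of `G` are in bijection with
the adjacency-respecting involutions `f : W → W` (`G.Adj v (f v)` and `f (f v) = v` for all `v`),
a matching `M` corresponding to `v ↦` its partner and `f` to the matching with dimers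
`{v, f v}`. [folklore] -/
noncomputable def perfectMatchingEquivPartner (G : SimpleGraph W) :
    {M : G.Subgraph // M.IsPerfectMatching} ≃
      {f : W → W // ∀ v, G.Adj v (f v) ∧ f (f v) = v} where
  toFun M := ⟨matchPartner M.2, fun v =>
    ⟨M.1.adj_sub (adj_matchPartner M.2 v), matchPartner_matchPartner M.2 v⟩⟩
  invFun f := ⟨partnerSubgraph G f.1 f.2, partnerSubgraph_isPerfectMatching G f.1 f.2⟩
  left_inv := by
    rintro ⟨M, hM⟩
    refine Subtype.ext (SimpleGraph.Subgraph.ext hM.2.verts_eq_univ.symm ?_)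
    funext v w
    exact propext ⟨fun h => h ▸ adj_matchPartner hM v, fun h => eq_matchPartner_of_adj hM h⟩
  right_inv := by
    rintro ⟨f, hf⟩
    refine Subtype.ext (funext fun v => ?_)
    exact (eq_matchPartner_of_adj (partnerSubgraph_isPerfectMatching G f hf) (v := v) (w := f v)
      rfl).symm

/-- Transport of partner maps along a graph isomorphism (conjugation by `e`). [folklore] -/
def partnerMapEquivOfIso (e : G ≃g G') :
    {f : W → W // ∀ v, G.Adj v (f v) ∧ f (f v) = v} ≃
      {f : W' → W' // ∀ v, G'.Adj v (f v) ∧ f (f v) = v} where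
  toFun f := ⟨fun v => e (f.1 (e.symm v)), fun v =>
    ⟨by simpa using e.map_adj_iff.2 (f.2 (e.symm v)).1,
     by simp [show ∀ x, f.1 (f.1 x) = x from fun x => (f.2 x).2]⟩⟩
  invFun f := ⟨fun v => e.symm (f.1 (e v)), fun v =>
    ⟨by simpa using e.symm.map_adj_iff.2 (f.2 (e v)).1,
     by simp [show ∀ x, f.1 (f.1 x) = x from fun x => (f.2 x).2]⟩⟩
  left_inv f := by ext v; simp
  right_inv f := by ext v; simp

/-- The number of perfect matchings is invariant under graph isomorphism. [folklore] -/
theorem card_perfectMatchings_eq_of_iso (e : G ≃g G') :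
    Nat.card {M : G.Subgraph // M.IsPerfectMatching} =
      Nat.card {M : G'.Subgraph // M.IsPerfectMatching} :=
  Nat.card_congr <| (perfectMatchingEquivPartner G).trans <|
    (partnerMapEquivOfIso e).trans (perfectMatchingEquivPartner G').symm

/-- A vertex lies in the support of its own connected component. [folklore] -/
theorem mem_supp_connectedComponentMk (G : SimpleGraph W) (v : W) :
    v ∈ (G.connectedComponentMk v).supp :=
  (SimpleGraph.ConnectedComponent.mem_supp_iff _ _).2 rfl

/-- Evaluating a family of component-wise partner maps does not depend on how the component of
the vertex is presented. [folklore] -/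
private theorem pi_partner_apply {G : SimpleGraph W}
    (g : (C : G.ConnectedComponent) →
      {g : C.supp → C.supp // ∀ v, (G.induce C.supp).Adj v (g v) ∧ g (g v) = v})
    {C : G.ConnectedComponent} (w : W) (hw : w ∈ C.supp) :
    ((g (G.connectedComponentMk w)).1 ⟨w, mem_supp_connectedComponentMk G w⟩).1 =
      ((g C).1 ⟨w, hw⟩).1 := by
  have hw' : G.connectedComponentMk w = C := hw
  subst hw'
  rfl

/-- A partner map of `G` is the same as a partner map on each connected component of `G`
(a vertex and its partner lie in the same component, and the components partition the
vertices). [folklore] -/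
def partnerMapEquivPi (G : SimpleGraph W) :
    {f : W → W // ∀ v, G.Adj v (f v) ∧ f (f v) = v} ≃
      ((C : G.ConnectedComponent) →
        {g : C.supp → C.supp // ∀ v, (G.induce C.supp).Adj v (g v) ∧ g (g v) = v}) where
  toFun f C := ⟨fun v => ⟨f.1 v, (C.mem_supp_congr_adj (f.2 v).1).1 v.2⟩, fun v =>
    ⟨(f.2 v).1, Subtype.ext (f.2 v).2⟩⟩
  invFun g :=
    ⟨fun v => ((g (G.connectedComponentMk v)).1 ⟨v, mem_supp_connectedComponentMk G v⟩).1,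
    fun v => ⟨((g (G.connectedComponentMk v)).2 ⟨v, mem_supp_connectedComponentMk G v⟩).1, by
      beta_reduce
      rw [pi_partner_apply g _
        ((g (G.connectedComponentMk v)).1 ⟨v, mem_supp_connectedComponentMk G v⟩).2]
      exact congrArg Subtype.val
        ((g (G.connectedComponentMk v)).2 ⟨v, mem_supp_connectedComponentMk G v⟩).2⟩⟩
  left_inv _ := rfl
  right_inv g :=
    funext fun _ => Subtype.ext (funext fun w => Subtype.ext (pi_partner_apply g w.1 w.2))

/-- **Multiplicativity over connected components.** The number of perfect matchings of a graph on
finitely many vertices is the product, over its connected components, of the numbers of perfect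
matchings of the components. [folklore] -/
theorem card_perfectMatchings_eq_finprod [Finite W] (G : SimpleGraph W) :
    Nat.card {M : G.Subgraph // M.IsPerfectMatching} =
      ∏ᶠ C : G.ConnectedComponent,
        Nat.card {M : (G.induce C.supp).Subgraph // M.IsPerfectMatching} := by
  have := Fintype.ofFinite G.ConnectedComponent
  rw [finprod_eq_prod_of_fintype,
    Nat.card_congr ((perfectMatchingEquivPartner G).trans (partnerMapEquivPi G)), Nat.card_pi]
  exact Finset.prod_congr rfl fun C _ => (Nat.card_congr (perfectMatchingEquivPartner _)).symm

end Partner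

/-! ### The dimer count of an induced sub-graph -/

section Count

variable {V V' : Type*}

/-- The number of **dimer covers** (perfect matchings) of the sub-graph of `H` induced on the
vertex set `S`: `Nat.card` of the type of perfect matchings of `H.induce S`. A dimer covering,
or perfect matching, of a graph is a set of edges covering every vertex exactly once
(Kenyon, *Lectures on dimers*, §1.1); their number is the dimer partition function with unit
weights (§3.1). For infinite `S` with infinitely many covers the value is the junk value `0` of
`Nat.card`; all intended uses have `S` finite (`finite_perfectMatchings`).
[cite: Kenyon2009, §1.1] -/
noncomputable def perfectMatchingCount (H : SimpleGraph V) (S : Set V) : ℕ :=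
  Nat.card {M : (H.induce S).Subgraph // M.IsPerfectMatching}

/-- Unfolding `perfectMatchingCount`. [cite: Kenyon2009, §1.1] -/
theorem perfectMatchingCount_def (H : SimpleGraph V) (S : Set V) :
    perfectMatchingCount H S = Nat.card {M : (H.induce S).Subgraph // M.IsPerfectMatching} :=
  rfl

/-- For a finite vertex set there are finitely many dimer covers, so `perfectMatchingCount` is a
genuine cardinality. [folklore] -/
theorem finite_perfectMatchings (H : SimpleGraph V) {S : Set V} (hS : S.Finite) :
    Finite {M : (H.induce S).Subgraph // M.IsPerfectMatching} := by
  have := hS.to_subtype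
  infer_instance

/-- For finite `S`, the dimer count is non-zero iff a dimer cover exists. [folklore] -/
theorem perfectMatchingCount_ne_zero_iff (H : SimpleGraph V) {S : Set V} (hS : S.Finite) :
    perfectMatchingCount H S ≠ 0 ↔ ∃ M : (H.induce S).Subgraph, M.IsPerfectMatching := by
  have := finite_perfectMatchings H hS
  rw [perfectMatchingCount, Nat.card_ne_zero]
  exact ⟨fun ⟨⟨M⟩, _⟩ => ⟨M.1, M.2⟩, 
    fun ⟨M, hM⟩ => ⟨⟨⟨M, hM⟩⟩, this⟩⟩

/-- The dimer count is invariant under isomorphism of the induced graphs. [folklore] -/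
theorem perfectMatchingCount_eq_of_iso {H : SimpleGraph V} {H' : SimpleGraph V'} {S : Set V}
    {S' : Set V'} (e : H.induce S ≃g H'.induce S') :
    perfectMatchingCount H S = perfectMatchingCount H' S' :=
  card_perfectMatchings_eq_of_iso e

/-- The dimer count only depends on the adjacency of `H` inside `S`. [folklore] -/
theorem perfectMatchingCount_congr {H H' : SimpleGraph V} {S : Set V}
    (h : ∀ x ∈ S, ∀ y ∈ S, (H.Adj x y ↔ H'.Adj x y)) :
    perfectMatchingCount H S = perfectMatchingCount H' S := by
  have e : H.induce S = H'.induce S := by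
    ext x y
    exact h x x.2 y y.2
  rw [perfectMatchingCount, perfectMatchingCount, e]

/-- The dimer count is invariant under graph isomorphisms `φ : H ≃g H'` (applied to the vertex
set as well). [folklore] -/
theorem perfectMatchingCount_image_iso {H : SimpleGraph V} {H' : SimpleGraph V'} (φ : H ≃g H')
    (S : Set V) : perfectMatchingCount H' (φ '' S) = perfectMatchingCount H S :=
  (perfectMatchingCount_eq_of_iso (φ.induce φ.injective.injOn.bijOn_image)).symm

/-- On the full vertex set, `perfectMatchingCount` counts the perfect matchings of `H` itself
(via Mathlib's `SimpleGraph.induceUnivIso`). [folklore] -/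
theorem perfectMatchingCount_univ (H : SimpleGraph V) :
    perfectMatchingCount H Set.univ = Nat.card {M : H.Subgraph // M.IsPerfectMatching} :=
  card_perfectMatchings_eq_of_iso H.induceUnivIso

/-- **The empty graph has exactly one dimer cover** (the empty one): `Z(∅) = 1`. [folklore] -/
theorem perfectMatchingCount_empty (H : SimpleGraph V) : perfectMatchingCount H ∅ = 1 := by
  rw [perfectMatchingCount, Nat.card_eq_one_iff_unique]
  refine ⟨⟨fun M N => Subtype.ext (SimpleGraph.Subgraph.ext (Subsingleton.elim _ _)
    (funext fun v => isEmptyElim v))⟩, ⟨⟨⊥, ?_⟩⟩⟩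
  rw [SimpleGraph.Subgraph.isPerfectMatching_iff]
  exact fun v => isEmptyElim v

/-- **Parity obstruction.** An odd number of sites admits no dimer cover (each dimer covers two
sites; Mathlib's `IsPerfectMatching.even_card`). [folklore] -/
theorem perfectMatchingCount_eq_zero_of_odd (H : SimpleGraph V) {S : Set V} (hS : Odd S.ncard) :
    perfectMatchingCount H S = 0 := by
  have hfin : S.Finite := Set.finite_of_ncard_pos hS.pos
  have := hfin.fintype
  rw [perfectMatchingCount, Nat.card_eq_zero]
  refine Or.inl ⟨fun M => ?_⟩
  have h := M.2.even_card
  rw [← Nat.card_eq_fintype_card, Nat.card_coe_set_eq] at h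
  exact Nat.not_even_iff_odd.2 hS h

/-- **Colour obstruction (bipartite graphs).** If `p` is a `2`-colouring of `H` (every edge joins
a `p`-site to a non-`p`-site) and `S` contains different numbers of sites of the two colours,
then `S` has no dimer cover: each dimer covers one site of each colour (Kenyon, *Lectures on
dimers*, §3.4, proof of Thm 2). The colouring only needs to be proper on `S`, and no finiteness
assumption is needed (`Set.ncard` conventions). [cite: Kenyon2009, §3.4] -/
theorem perfectMatchingCount_eq_zero_of_ncard_ne (H : SimpleGraph V) {S : Set V}
    (p : V → Prop) (hp : ∀ x ∈ S, ∀ y ∈ S, H.Adj x y → (p x ↔ ¬ p y))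
    (hne : {x ∈ S | p x}.ncard ≠ {x ∈ S | ¬ p x}.ncard) : perfectMatchingCount H S = 0 := by
  rw [perfectMatchingCount, Nat.card_eq_zero]
  refine Or.inl ⟨fun M => hne ?_⟩
  obtain ⟨f, hf⟩ := perfectMatchingEquivPartner _ M
  have hflip : ∀ v : S, p v ↔ ¬ p (f v) := fun v => hp v v.2 (f v) (f v).2 (hf v).1
  have hback : ∀ v : S, ¬ p v → p (f v) := fun v hv => by
    have h := hflip (f v)
    rw [(hf v).2] at h
    exact h.2 hv
  rw [← Nat.card_coe_set_eq, ← Nat.card_coe_set_eq]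
  exact Nat.card_congr
    { toFun := fun x => ⟨f ⟨x, x.2.1⟩, (f ⟨x, x.2.1⟩).2, (hflip ⟨x, x.2.1⟩).1 x.2.2⟩
      invFun := fun y => ⟨f ⟨y, y.2.1⟩, (f ⟨y, y.2.1⟩).2, hback ⟨y, y.2.1⟩ y.2.2⟩
      left_inv := fun x => Subtype.ext (by
        change ((f (f ⟨x, x.2.1⟩) : S) : V) = x
        rw [(hf _).2])
      right_inv := fun y => Subtype.ext (by
        change ((f (f ⟨y, y.2.1⟩) : S) : V) = y
        rw [(hf _).2]) }

/-- **Multiplicativity of the dimer count over connected components**: for finite `S`,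
`Z(H|S) = ∏_C Z(C)`, the product over the connected components `C` of `H.induce S` of the
number of dimer covers of `C` (a dimer never joins two components). In particular the count
vanishes as soon as one component has no dimer cover. [folklore] -/
theorem perfectMatchingCount_eq_finprod (H : SimpleGraph V) {S : Set V} (hS : S.Finite) :
    perfectMatchingCount H S =
      ∏ᶠ C : (H.induce S).ConnectedComponent, perfectMatchingCount (H.induce S) C.supp := by
  have := hS.to_subtype
  exact card_perfectMatchings_eq_finprod (H.induce S)

end Count

/-! ### Dimer counts on `ℤ^d` -/

section Lattice

variable {d : ℕ}

/-- Nearest neighbours of `ℤ^d` have coordinate sums of opposite parity (the chessboard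
colouring of `ℤ^d` is a proper `2`-colouring). [folklore] -/
theorem zdGraph_adj_even_sum_iff {x y : Site d} (h : (zdGraph d).Adj x y) :
    Even (∑ i, x i) ↔ ¬ Even (∑ i, y i) := by
  have key : ∀ {a b : Site d} (i : Fin d), b = a + Pi.single i 1 →
      ∑ j, b j = ∑ j, a j + 1 := by
    rintro a b i rfl
    simp [Finset.sum_add_distrib]
  obtain ⟨i, h | h⟩ := (zdGraph_adj_iff x y).1 h
  · rw [key i h, Int.even_add_one, not_not]
  · rw [key i h, Int.even_add_one]

/-- **Chessboard obstruction on `ℤ^d`.** For a sub-graph `H` of the nearest-neighbour graph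
`ℤ^d` and a vertex set `S` with different numbers of even (`∑ xᵢ` even) and odd sites, there
is no dimer cover of `H.induce S`: every dimer of `ℤ^d` covers one even and one odd site
(Kenyon, *Lectures on dimers*, §3.4). [cite: Kenyon2009, §3.4] -/
theorem perfectMatchingCount_eq_zero_of_chessboard {H : SimpleGraph (Site d)}
    (hH : H ≤ zdGraph d) {S : Set (Site d)}
    (hne : {x ∈ S | Even (∑ i, x i)}.ncard ≠ {x ∈ S | ¬ Even (∑ i, x i)}.ncard) :
    perfectMatchingCount H S = 0 :=
  perfectMatchingCount_eq_zero_of_ncard_ne H (fun x => Even (∑ i, x i))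
    (fun _ _ _ _ h => zdGraph_adj_even_sum_iff (hH h)) hne

/-- Translation by `v` as an automorphism of the nearest-neighbour graph `ℤ^d`
(`zdGraph_adj_shift_iff`). (Friedli–Velenik 2017, §3.1, translation invariance.)
[cite: FriedliVelenik2017, §3.1] -/
def zdGraphShiftIso (v : Site d) : zdGraph d ≃g zdGraph d where
  toEquiv := Site.shift v
  map_rel_iff' := zdGraph_adj_shift_iff v _ _

/-- `zdGraphShiftIso v` acts as `x ↦ x + v`. [cite: FriedliVelenik2017, §3.1] -/
@[simp] theorem zdGraphShiftIso_apply (v x : Site d) : zdGraphShiftIso v x = x + v := rfl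

/-- **Translation invariance** of dimer counts on `ℤ^d`. [folklore] -/
theorem perfectMatchingCount_zdGraph_image_shift (v : Site d) (S : Set (Site d)) :
    perfectMatchingCount (zdGraph d) (Site.shift v '' S) = perfectMatchingCount (zdGraph d) S :=
  perfectMatchingCount_image_iso (zdGraphShiftIso v) S

/-! ### The `2 × 2` block -/

/-- The `4`-cycle realised as the unit square `{0,1}²` (vertex type `Bool × Bool`): two corners
are adjacent iff they differ in exactly one coordinate. [folklore] -/
def squareGraph : SimpleGraph (Bool × Bool) where
  Adj x y := x.1 = y.1 ↔ x.2 ≠ y.2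
  symm := ⟨fun x y h => by rw [eq_comm, h, ne_comm]⟩
  loopless := ⟨fun x h => by simp at h⟩

/-- Adjacency in `squareGraph`, unfolded. [folklore] -/
theorem squareGraph_adj (x y : Bool × Bool) :
    squareGraph.Adj x y ↔ (x.1 = y.1 ↔ x.2 ≠ y.2) :=
  Iff.rfl

/-- Adjacency in `squareGraph` is decidable (by its defining formula). [folklore] -/
instance : DecidableRel squareGraph.Adj := fun x y =>
  inferInstanceAs (Decidable (x.1 = y.1 ↔ x.2 ≠ y.2))

/-- **The `4`-cycle has exactly two perfect matchings** (the two pairs of opposite sides),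
by exhaustion over partner maps. [folklore] -/
theorem card_perfectMatchings_squareGraph :
    Nat.card {M : squareGraph.Subgraph // M.IsPerfectMatching} = 2 := by
  rw [Nat.card_congr (perfectMatchingEquivPartner squareGraph), Nat.card_eq_fintype_card]
  decide

/-- The corner `b + (s, t)` (`s, t ∈ {0, 1}`) of the `2 × 2` block of `ℤ²` with lower-left
corner `b`. [folklore] -/
def squareCorner (b : Site 2) (p : Bool × Bool) : Site 2 :=
  ![b 0 + (if p.1 then 1 else 0), b 1 + (if p.2 then 1 else 0)]

/-- `squareCorner b` evaluated at the two coordinates. [folklore] -/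
@[simp] theorem squareCorner_apply_zero (b : Site 2) (p : Bool × Bool) :
    squareCorner b p 0 = b 0 + (if p.1 then 1 else 0) := rfl

/-- `squareCorner b` evaluated at the two coordinates. [folklore] -/
@[simp] theorem squareCorner_apply_one (b : Site 2) (p : Bool × Bool) :
    squareCorner b p 1 = b 1 + (if p.2 then 1 else 0) := rfl

/-- The corners of the block are the sites of the order interval `[b, b + 1]` of `ℤ²`.
[folklore] -/
theorem squareCorner_mem_Icc (b : Site 2) (p : Bool × Bool) :
    squareCorner b p ∈ Set.Icc b (b + 1) := by
  rw [Set.mem_Icc, Pi.le_def, Pi.le_def, Fin.forall_fin_two, Fin.forall_fin_two]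
  rcases p with ⟨_ | _, _ | _⟩ <;> simp

/-- Two corners of the block are nearest neighbours in `ℤ²` iff they differ in exactly one
coordinate. [folklore] -/
theorem zdGraph_adj_squareCorner_iff (b : Site 2) (p q : Bool × Bool) :
    (zdGraph 2).Adj (squareCorner b p) (squareCorner b q) ↔ squareGraph.Adj p q := by
  rw [zdGraph_adj_iff, squareGraph_adj, Fin.exists_fin_two]
  simp only [funext_iff, Fin.forall_fin_two, Pi.add_apply, squareCorner_apply_zero,
    squareCorner_apply_one, Pi.single_apply]
  rcases p with ⟨_ | _, _ | _⟩ <;> rcases q with ⟨_ | _, _ | _⟩ <;> simp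

/-- The `2 × 2` block `[b, b + 1]` of `ℤ²`, with its nearest-neighbour edges, is the `4`-cycle:
the graph isomorphism `squareGraph ≃g (zdGraph 2).induce (Set.Icc b (b + 1))` given by
`squareCorner b`. [folklore] -/
noncomputable def squareIso (b : Site 2) :
    squareGraph ≃g (zdGraph 2).induce (Set.Icc b (b + 1)) where
  toFun p := ⟨squareCorner b p, squareCorner_mem_Icc b p⟩
  invFun y := (decide (y.1 0 ≠ b 0), decide (y.1 1 ≠ b 1))
  left_inv p := by
    rcases p with ⟨_ | _, _ | _⟩ <;> simp
  right_inv y := by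
    obtain ⟨y, hy⟩ := y
    rw [Set.mem_Icc, Pi.le_def, Pi.le_def, Fin.forall_fin_two, Fin.forall_fin_two] at hy
    simp only [Pi.add_apply, Pi.one_apply] at hy
    refine Subtype.ext (funext fun i => ?_)
    fin_cases i
    · simp only [ne_eq, decide_not, squareCorner_apply_zero, Bool.not_eq_eq_eq_not,
        Bool.not_true, decide_eq_false_iff_not, Fin.zero_eta]
      split_ifs with h <;> omega
    · simp only [ne_eq, decide_not, squareCorner_apply_one, Bool.not_eq_eq_eq_not,
        Bool.not_true, decide_eq_false_iff_not, Fin.mk_one]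
      split_ifs with h <;> omega
  map_rel_iff' := zdGraph_adj_squareCorner_iff b _ _

/-- **A `2 × 2` block of `ℤ²` has exactly two dimer covers** (two horizontal or two vertical
dimers): `perfectMatchingCount (zdGraph 2) [b, b + 1] = 2` for every `b ∈ ℤ²`. For a sub-graph
`H ≤ zdGraph 2` containing all four sides of the block use `perfectMatchingCount_congr` first.
[folklore] -/
theorem perfectMatchingCount_zdGraph_two_Icc (b : Site 2) :
    perfectMatchingCount (zdGraph 2) (Set.Icc b (b + 1)) = 2 := by
  rw [perfectMatchingCount, ← card_perfectMatchings_eq_of_iso (squareIso b)]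
  exact card_perfectMatchings_squareGraph

end Lattice

end Literature.Probability.LatticeModels
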